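import Summits.BirchSwinnertonDyer.BirchSwinnertonDyer.Theorems.GoldfeldAllTwistsTwoConverseTwinQuarterTraceChiZAlpha
import Summits.BirchSwinnertonDyer.BirchSwinnertonDyer.Theorems.GoldfeldAllTwistsTwoConverseTwinQuarterTraceChiZTrace
import Mathlib.GroupTheory.OrderOfElement
import HarnessLib

set_option linter.dupNamespace false -- namespace `…BirchSwinnertonDyer.BirchSwinnertonDyer…` is the cell's (D-0017 nested layout)
set_option autoImplicit false

/-!
# The χ_Z CHANNEL as a NON-TORSION mechanism: a quarter point moved by the genus lift `σ̃_p` forces the conductor-`1` Heegner trace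
# off the torsion (FACT-FREE core + its trace form + the end-to-end certificate on the landed α cell C4)

Cell `bsd-goldfeld`, seat `bsd-goldfeld-s1p-c3x` (gen 13); planner RULING (ccclx) «OBJECT C7A BY THE χ_Z CHANNEL», tranche T1, file Z1 (memo
`HOME/C7A-CHIZ-CHANNEL.md`; director-bsd no-objection 20:49Z). `--supports stmt-BirchSwinnertonDyer-20044` as a HELPER (rank axis). Theses-free;
theorems only; no definition, no new fact, no `sorry`. FRONTIER-grade: serves a twist-density-ZERO sub-family modulo named print; never distance-to-summit.

§1 FACT-FREE core `not_isOfFinAddOrder_of_chiZ`: a quarter point `4•Z = N•y + t` moved by a lift `σ` off the `2`-torsion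
(`σ(n•Z) − n•Z = T`, `n` odd) forces `y` to have infinite order (`M[4] ⊆ {0,T}`, `σT = T`).
§2 `trace_not_isOfFinAddOrder_of_quarterPoint`: the same for the conductor-`1` trace `Σ_σ σy₁ ∈ X₀(49)(K[1])` (torsion control from
(F-norm) `hEta` exactly as in `halvingExactlyOnce_trace_of_quarterPoint`).
§3 END-TO-END CERTIFICATE on the landed α cell C4 (documentation theorem, X5α-χ's binders letter for letter):
`heegnerTrace_not_isOfFinAddOrder_alpha_of_h2` = §2 ∘ `exists_quarterPoint_chiZ_alpha` (`…TwinQuarterTraceChiZAlpha`): GRANTED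
`h2 : r_an(49a1^{(−qp)}) = 1`, the trace is non-torsion — WITHOUT the `(1+c)`-parity `quarterTrace_parity` (A⁗_α's channel, `…TwinQuarterTraceCore`).
On C4 this is redundant (A⁗_α); the SAME composition with `hp8 : p % 8 = 1` decides the RANK AXIS of the `(†)`-silent cell C7A (= C3) modulo `h2`
(files Z2/Z3 of the order).
HONEST FRAMING: group algebra and a composition of landed theorems; conditional on `h2` where stated; items 19140 / 19350 / 20044 unchanged; BSD is not
proved by any of this.

References: [GrossLMS1991] Prop. 5.3; [Gross1984] §§4–5; [CoatesLiTianZhai2015] Thm. 2.5, Thm. 1.3–1.4, 4.4, (2.8).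
-/

noncomputable section

open scoped Classical IntermediateField

open WeierstrassCurve NumberField Literature.NumberTheory Literature.NumberTheory.EllipticCurves
  Literature.NumberTheory.EllipticCurves.ModularForms Literature.NumberTheory.EllipticCurves.CaiShuTian2014
  Literature.NumberTheory.EllipticCurves.CoatesLiTianZhai2015 Literature.Computability.Cryptography.Hallgren2005

namespace Summit.BirchSwinnertonDyer.BirchSwinnertonDyer.Theorems.GoldfeldGoodTwists

section ChiZNonTorsion

variable {M : Type*} [AddCommGroup M]

/-- `M[4] ⊆ {0, T}` propagates to every `2`-power: `2^k • x = 0 ⇒ x ∈ {0, T}` (`2T = 0`). [folklore] -/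
theorem mem_pair_of_two_pow_zsmul_eq_zero {T : M} (hT2 : 2 • T = 0)
    (h4 : ∀ x : M, (4 : ℤ) • x = 0 → x = 0 ∨ x = T) :
    ∀ (k : ℕ) (x : M), ((2 : ℤ) ^ k) • x = 0 → x = 0 ∨ x = T := by
  have hT2z : (2 : ℤ) • T = 0 := by exact_mod_cast hT2
  intro k
  induction k with
  | zero => intro x hx; left; simpa using hx
  | succ k ih =>
    intro x hx
    -- `2^k • (2 • x) = 0`, so `2 • x ∈ {0, T}`, so `4 • x = 0`
    have h2x : ((2 : ℤ) ^ k) • ((2 : ℤ) • x) = 0 := by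
      rw [smul_smul, ← pow_succ]; exact hx
    have h4x : (4 : ℤ) • x = 0 := by
      rcases ih _ h2x with h | h
      · rw [show (4 : ℤ) = 2 * 2 by norm_num, mul_zsmul, h, zsmul_zero]
      · rw [show (4 : ℤ) = 2 * 2 by norm_num, mul_zsmul, h, hT2z]
    exact h4 x h4x

/-- A torsion element has an ODD multiple in `M[2^∞]`, hence in `{0, T}` when `M[4] ⊆ {0, T}`. [folklore] -/
theorem exists_odd_zsmul_mem_pair_of_isOfFinAddOrder {T : M} (hT2 : 2 • T = 0)
    (h4 : ∀ x : M, (4 : ℤ) • x = 0 → x = 0 ∨ x = T) {x : M} (hx : IsOfFinAddOrder x) :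
    ∃ m : ℤ, Odd m ∧ (m • x = 0 ∨ m • x = T) := by
  have hpos : 0 < addOrderOf x := hx.addOrderOf_pos
  obtain ⟨k, m, hm, hkm⟩ := Nat.exists_eq_two_pow_mul_odd hpos.ne'
  refine ⟨(m : ℤ), by exact_mod_cast hm, ?_⟩
  apply mem_pair_of_two_pow_zsmul_eq_zero hT2 h4 k
  rw [smul_smul, show (2 : ℤ) ^ k * (m : ℤ) = ((2 ^ k * m : ℕ) : ℤ) by push_cast; ring, natCast_zsmul, ← hkm]
  exact addOrderOf_nsmul_eq_zero x

/-- **The χ_Z non-torsion principle.** `σ : M →+ M` with `σT = T`; `2T = 0`, `T ≠ 0`, `M[4] ⊆ {0, T}`; a quarter point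
`4•Z = N•y + t`, `t ∈ {0, T}`; an odd `n` with `σ(n•Z) − n•Z = T`. Then `y` has infinite order. [cite: GrossLMS1991, Prop. 5.3]
[cite: CoatesLiTianZhai2015, Thm. 2.5] -/
theorem not_isOfFinAddOrder_of_chiZ (σ : M →+ M) {T : M} (hT2 : 2 • T = 0) (hT0 : T ≠ 0) (hσT : σ T = T)
    (h4 : ∀ x : M, (4 : ℤ) • x = 0 → x = 0 ∨ x = T) {Z y t : M} {N : ℤ}
    (ht : t = 0 ∨ t = T) (hZ : (4 : ℤ) • Z = N • y + t)
    (hχ : ∃ n : ℤ, Odd n ∧ σ (n • Z) - n • Z = T) : ¬ IsOfFinAddOrder y := by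
  intro hy
  obtain ⟨n, hn, hnZ⟩ := hχ
  -- `t` and `N • y` are torsion, hence so are `4 • Z` and `Z`
  have htfin : IsOfFinAddOrder t := by
    rcases ht with rfl | rfl
    · exact isOfFinAddOrder_iff_nsmul_eq_zero.mpr ⟨1, one_pos, by rw [one_nsmul]⟩
    · exact isOfFinAddOrder_iff_nsmul_eq_zero.mpr ⟨2, two_pos, hT2⟩
  have h4Z : IsOfFinAddOrder ((4 : ℤ) • Z) := by rw [hZ]; exact (IsOfFinAddOrder.zsmul hy).add htfin
  have hZfin : IsOfFinAddOrder Z := by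
    obtain ⟨k, hk, hk0⟩ := isOfFinAddOrder_iff_nsmul_eq_zero.mp h4Z
    refine isOfFinAddOrder_iff_zsmul_eq_zero.mpr ⟨(k : ℤ) * 4, by positivity, ?_⟩
    rw [mul_zsmul, natCast_zsmul, hk0]
  -- an odd multiple `m • Z` lies in `{0, T}`, which `σ` fixes
  obtain ⟨m, hm, hmZ⟩ := exists_odd_zsmul_mem_pair_of_isOfFinAddOrder hT2 h4 hZfin
  have hfix : σ (n • (m • Z)) - n • (m • Z) = 0 := by
    rcases hmZ with h | h
    · rw [h, zsmul_zero, map_zero, sub_zero]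
    · rw [h, zsmul_twoTorsion_of_odd hT2 hn, hσT, sub_self]
  -- but `m • (σ(n•Z) − n•Z) = m • T = T`
  have hmul : m • (σ (n • Z) - n • Z) = σ (n • (m • Z)) - n • (m • Z) := by
    rw [zsmul_sub, ← map_zsmul, smul_smul, smul_smul, mul_comm m n]
  apply hT0
  rw [← zsmul_twoTorsion_of_odd hT2 hm, ← hnZ, hmul, hfix]

end ChiZNonTorsion

/-! ## §2 The trace version over `K[1]` -/
section Trace

-- the cell's point-group world over `K[1]` / `ℂ`; file-local
attribute [local instance 2000] Classical.propDecidable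

variable {K : Type} [Field K] [NumberField K]

/-- **A quarter point with `χ_Z(σ̃) = T` forces the conductor-`1` trace off the torsion.** Same data as
`halvingExactlyOnce_trace_of_quarterPoint`; torsion control `X₀(49)(K[1])[4] ⊆ {O,T}` from (F-norm). [cite: GrossLMS1991, Prop. 5.3]
[cite: CoatesLiTianZhai2015, Thm. 2.5] -/
theorem trace_not_isOfFinAddOrder_of_quarterPoint (hEta : x049_heegner_norm_x_sub_two_not_mem) (hK : IsImaginaryQuadratic K)
    (ι : K →+* ℂ) [FiniteDimensional K (ringClassField K ι 1)] [IsGalois K (ringClassField K ι 1)]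
    (D₀ : ModularParametrizationData cm7 49) (hc : |D₀.c| = 1) {β : ℤ} (d : KolyvaginHeegnerData D₀ β ι 1)
    (σt : ringClassField K ι 1 ≃ₐ[K] ringClassField K ι 1) {N : ℤ} {Z t : (cm7.baseChange (ringClassField K ι 1)).toAffine.Point}
    (ht : t = 0 ∨ t = Affine.Point.some 2 (-1) (nonsingular_cm7_baseChange_two_neg_one (ringClassField K ι 1)))
    (hZ4 : (4 : ℤ) • Z = N • (∑ σ : ringClassField K ι 1 ≃ₐ[K] ringClassField K ι 1,
          Affine.Point.map (σ : ringClassField K ι 1 →ₐ[K] ringClassField K ι 1) d.y) + t)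
    (hχ : ∃ n : ℤ, Odd n ∧ Affine.Point.map (σt : ringClassField K ι 1 →ₐ[K] ringClassField K ι 1) (n • Z) - n • Z =
        Affine.Point.some 2 (-1) (nonsingular_cm7_baseChange_two_neg_one (ringClassField K ι 1))) :
    ¬ IsOfFinAddOrder (∑ σ : ringClassField K ι 1 ≃ₐ[K] ringClassField K ι 1,
        Affine.Point.map (σ : ringClassField K ι 1 →ₐ[K] ringClassField K ι 1) d.y) := by
  haveI : (cm7.baseChange (ringClassField K ι 1)).IsElliptic := by rw [WeierstrassCurve.baseChange]; infer_instance
  obtain ⟨x₁, y₁, hxy, hdy, b, v, hnorm, h7v, h7v2, hbv⟩ := by first | exact hEta K ι D₀ hc β d | exact hEta K ι hK D₀ hc β d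
  obtain ⟨h7, h7'⟩ := not_isSquare_seven_ringClassField_one hK ι h7v h7v2
  have h4 : ∀ x : (cm7.baseChange (ringClassField K ι 1)).toAffine.Point, (4 : ℤ) • x = 0 →
      x = 0 ∨ x = Affine.Point.some 2 (-1) (nonsingular_cm7_baseChange_two_neg_one (ringClassField K ι 1)) := fun x hx ↦
    cm7_mem_pair_of_four_zsmul_eq_zero h7 h7' hx
  have hσT : Affine.Point.map (σt : ringClassField K ι 1 →ₐ[K] ringClassField K ι 1)
        (Affine.Point.some 2 (-1) (nonsingular_cm7_baseChange_two_neg_one (ringClassField K ι 1))) =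
        Affine.Point.some 2 (-1) (nonsingular_cm7_baseChange_two_neg_one (ringClassField K ι 1)) := by
    rw [Affine.Point.map_some]; congr 1
    · exact map_ofNat _ 2
    · rw [map_neg, map_one]
  have hT2 : 2 • Affine.Point.some 2 (-1) (nonsingular_cm7_baseChange_two_neg_one (ringClassField K ι 1)) = 0 := by
    rw [two_nsmul]; exact cm7_twoTorsion_add_self _
  have hT0 : Affine.Point.some 2 (-1) (nonsingular_cm7_baseChange_two_neg_one (ringClassField K ι 1)) ≠ 0 := by
    intro h; cases h
  exact not_isOfFinAddOrder_of_chiZ (Affine.Point.map (σt : ringClassField K ι 1 →ₐ[K] ringClassField K ι 1)) hT2 hT0 hσT h4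
    ht hZ4 hχ

end Trace

/-! ## §3 End-to-end certificate on the landed α cell C4: `h2 ⇒` the trace is non-torsion, by the χ_Z channel alone -/
section CellC4
variable {K : Type} [Field K] [NumberField K] (ι : K →+* ℂ) [FiniteDimensional K (ringClassField K ι 1)]
  [IsGalois K (ringClassField K ι 1)] [NumberField (ringClassField K ι 1)]

-- the cell's point-group world over `K[1]` / `ℂ`; file-local
attribute [local instance 2000] Classical.propDecidable

/-- **C4, type α, GRANTED `h2`: the conductor-`1` trace is non-torsion via `χ_Z(σ̃_p) = T`** (no `(1+c)`-parity used).
[cite: Gross1984, §§4–5] [cite: GrossLMS1991, Prop. 5.3] [cite: CoatesLiTianZhai2015, Thm. 1.3, 1.4, 4.4 and (2.8)] -/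
theorem heegnerTrace_not_isOfFinAddOrder_alpha_of_h2 (hEta₀ : x049_x_sub_two_eq_etaQuotient) (hD : deuring_etaQuotient49_heegner_generates_conjPrime)
    (hEta : x049_heegner_norm_x_sub_two_not_mem) (h14 : thm14_rankOne_twist) (hCST : thm11_ringClassChar)
    (hGZ : ∀ (N : ℕ) [NeZero N] (W : WeierstrassCurve ℚ) (K : Type) [Field K] [NumberField K], gross_zagier N W K)
    (h12 : thm12_fullBSD_twist) (h44 : thm44_ord_two_LAlg)
    (hS31 : bsdTriple_of_rank_le_one_of_conductor_lt) (hnew : exists_isNewformOf)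
    (hBT : burungaleTian_analyticRank_eq_zero_of_selmerCorank_eq_zero_of_hasCM) (hBF : bsdTriple_of_hasCM_of_L_one_ne_zero)
    (hGZK : rank_eq_analyticRank_of_analyticRank_le_one)
    (hK : IsImaginaryQuadratic K) {q p : ℕ} (hq : q.Prime) (hq8 : q % 8 = 7) (hq7 : jacobiSym q 7 = -1)
    [Fact p.Prime] (hp8 : p % 8 = 5) (hp7 : legendreSym p (-7) = 1) (hα : ¬ ∃ x : ZMod p, x ^ 4 = -7)
    (h4e : ∀ Δ : OrderCl.NegDiscr, Δ.D = -((q : ℤ) * p) → ¬ 4 ∣ Nat.card (ClassGroup (OrderCl.QO Δ)))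
    (h2 : (haveI := cm7.isElliptic_quadraticTwist (show (-((q : ℚ) * p)) ≠ 0 from neg_ne_zero.mpr (mul_ne_zero
        (by exact_mod_cast hq.ne_zero) (by exact_mod_cast (Fact.out : p.Prime).ne_zero)));
      (cm7.quadraticTwist (-((q : ℚ) * p))).analyticRank) = 1)
    (hA : ∀ (K₂ : Type) [Field K₂] [NumberField K₂], IsImaginaryQuadratic K₂ → NumberField.discr K₂ = -(8 * (q : ℤ)) →
      ∀ P : (cm7.baseChange K₂).toAffine.Point, IsHeegnerPoint 49 cm7 K₂ P → ¬ IsOfFinAddOrder P)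
    (har : ∀ (W : WeierstrassCurve ℚ) [W.IsElliptic] (C : VariableChange ℚ),
      C • W = cm7.quadraticTwist ((-2 * q : ℤ) : ℚ) → W.analyticRank = 1)
    (hdK : NumberField.discr K = -(8 * (q : ℤ) * p))
    (D₀ : ModularParametrizationData cm7 49) (hc : |D₀.c| = 1) (hw : cm7.rootNumber = 1)
    (h0 : ∃ h, D₀.cuspZeroPoint = Affine.Point.some 2 (-1) h)
    {β : ℤ} (d : KolyvaginHeegnerData D₀ β ι 1) {rq rp : ringClassField K ι 1}
    (hrq : (rq : ℂ) ^ 2 = -(q : ℂ)) (hrp : (rp : ℂ) ^ 2 = (p : ℂ))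
    (B : AddSubgroup (cm7.baseChange ℂ).toAffine.Point) (S : Subfield ℂ)
    (hBfix : ∀ P : (cm7.baseChange (ringClassField K ι 1)).toAffine.Point,
      (∀ σ : ringClassField K ι 1 ≃ₐ[K] ringClassField K ι 1, σ rq = rq → σ rp = rp →
        Affine.Point.map (σ : ringClassField K ι 1 →ₐ[K] ringClassField K ι 1) P = P) →
      Affine.Point.map (W' := cm7) (ringClassField K ι 1).subtype.toRatAlgHom P ∈ B)
    (hBodd : ∀ u ∈ B, IsOfFinAddOrder u → ∃ n : ℤ, Odd n ∧
      (n • u = 0 ∨ n • u = Affine.Point.some 2 (-1) (nonsingular_cm7_baseChange_two_neg_one ℂ)))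
    (hBS : ∀ (E : Type) [Field E] [CharZero E] (e : E →+* ℂ), e.fieldRange ≤ S →
      ∀ z : (cm7.baseChange E).toAffine.Point, Affine.Point.map (W' := cm7) e.toRatAlgHom z ∈ B)
    (hSK : ∀ k : K, ι k ∈ S) (hSq : (rq : ℂ) ∈ S) (hSp : (rp : ℂ) ∈ S)
    (hBL : ∀ z ∈ B, ∃ P : (cm7.baseChange (ringClassField K ι 1)).toAffine.Point,
      Affine.Point.map (W' := cm7) (ringClassField K ι 1).subtype.toRatAlgHom P = z)
    (h7 : ¬ IsSquare (-7 : ringClassField K ι 1)) (h7' : ¬ IsSquare (7 : ringClassField K ι 1))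
    (σt : ringClassField K ι 1 ≃ₐ[K] ringClassField K ι 1) (hσq : σt rq = rq) (hσp : σt rp = -rp) :
    ¬ IsOfFinAddOrder (∑ σ : ringClassField K ι 1 ≃ₐ[K] ringClassField K ι 1,
        Affine.Point.map (σ : ringClassField K ι 1 →ₐ[K] ringClassField K ι 1) d.y) := by
  obtain ⟨N, Z, t, hN, ht, hZ4, hχ⟩ := exists_quarterPoint_chiZ_alpha ι hEta₀ hD hEta h14 hCST hGZ h12 h44 hS31 hnew hBT hBF hGZK hK hq
    hq8 hq7 hp8 hp7 hα h4e h2 hA har hdK D₀ hc hw h0 d hrq hrp B S hBfix hBodd hBS hSK hSq hSp hBL h7 h7' σt hσq hσp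
  exact trace_not_isOfFinAddOrder_of_quarterPoint hEta hK ι D₀ hc d σt ht hZ4 hχ

end CellC4

end Summit.BirchSwinnertonDyer.BirchSwinnertonDyer.Theorems.GoldfeldGoodTwists
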